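import Summits.Ventures.HSemireg.LexLeaderSoundness
import Summits.Ventures.HSemireg.LexChainEncoding
import Mathlib.Algebra.Group.Subgroup.Actions
import HarnessLib

/-!
# Venture HSemireg — LEX-LEADER SYMMETRY BREAKING, END TO END (soundness ∘ encoding)

Composition of the two tree files of premise NEW-3 of the door-(I) TRIPLE-PIN `--lexstab` legs
(cell pub-hsemireg, seat s0-2; `step0/B/RESULT-B21.md` §3):
* `LexLeaderSoundness` (ladder row 264): for a finite group of syntactic symmetries, side constraints implied by
  orbit-maximality do not change satisfiability;
* `LexChainEncoding` (row 417): the chain clauses of `stabsym.add_lexstab` for `σ` are satisfiable iff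
  `x ≥_lex (x_{σ(i)})_i`, and that holds whenever `x` is not lex-below `x ∘ σ` in `Lex (Fin n → Bool)`.

Here the permutation group acts on assignments `Lex (Fin n → Bool)` by `(σ • a) i = a (σ⁻¹ i)` (so that
`a ∘ σ = σ⁻¹ • a`), and the END-TO-END statement is: for a CNF-predicate `F` on `n` Boolean variables invariant
under a subgroup `G` of `Equiv.Perm (Fin n)`, `F` is satisfiable iff `F` is satisfiable TOGETHER WITH, for every
`σ ∈ G` and every prefix length `m`, the chain clauses over the `σ`-moved positions truncated at `m` — which is
what the legs add (for their chosen generators and prefix; any sub-selection is weaker still).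

HONEST FRAMING.  Finite group actions, lists and Booleans; that the concrete permutations ARE symmetries of
encoder B's clause families (NEW-1) is a machine-checked premise (kit j228328 ∕ j222029), not a theorem here.
Nothing here bears on HC ∕ HC_CM ∕ HC_AV.
-/

namespace Summit.Ventures.HSemireg
namespace LexChain

open LexLeader

/-- Permutations of the positions act on assignments (in the lexicographic type synonym) by
`(σ • a) i = a (σ⁻¹ i)`.  A `def`, switched on as a LOCAL instance below only (no global instance on a Mathlib
type is declared by this file). -/
@[reducible] def permMulActionLex (n : ℕ) : MulAction (Equiv.Perm (Fin n)) (Lex (Fin n → Bool)) where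
  smul σ a := toLex fun i => ofLex a (σ⁻¹ i)
  one_smul a := by
    apply (Equiv.injective ofLex)
    funext i; rfl
  mul_smul σ τ a := by
    apply (Equiv.injective ofLex)
    funext i
    show ofLex a ((σ * τ)⁻¹ i) = ofLex a (τ⁻¹ (σ⁻¹ i))
    simp only [mul_inv_rev, Equiv.Perm.coe_mul, Function.comp_apply]

section EndToEnd

attribute [local instance] permMulActionLex

/-- The local action unfolded pointwise: `(σ • a) i = a (σ⁻¹ i)`. -/
theorem perm_smul_lex_apply {n : ℕ} (σ : Equiv.Perm (Fin n)) (a : Lex (Fin n → Bool)) (i : Fin n) :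
    ofLex (σ • a) i = ofLex a (σ⁻¹ i) := rfl

/-- The image `a ∘ σ` compared by the chain for `σ` is the group element `σ⁻¹` applied to `a`. -/
theorem toLex_comp_eq_inv_smul {n : ℕ} (σ : Equiv.Perm (Fin n)) (a : Lex (Fin n → Bool)) :
    toLex (ofLex a ∘ σ) = σ⁻¹ • a := by
  apply (Equiv.injective ofLex)
  funext i
  simp only [perm_smul_lex_apply, inv_inv]
  rfl

/-- END TO END.  `F` invariant under the subgroup `G` of position permutations ⇒ (`F` satisfiable iff `F` is
satisfiable together with ALL chain constraints: for every `σ ∈ G` and every prefix length `m`, some auxiliary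
values satisfy the chain over the `σ`-moved positions truncated at `m`). The legs use finitely many `σ` and one
`m`; dropping constraints only weakens the right-hand side, so their clause sets are covered a fortiori. -/
theorem sat_iff_sat_with_chains {n : ℕ} (G : Subgroup (Equiv.Perm (Fin n))) [Fintype G]
    (F : Lex (Fin n → Bool) → Prop) (hF : ∀ (g : G) (a : Lex (Fin n → Bool)), F a → F (g • a)) :
    (∃ a, F a) ↔ ∃ a, F a ∧ ∀ g : G, ∀ m : ℕ, ∃ es,
      chainSat true ((((List.ofFn fun i => (ofLex a i, ofLex a ((g : Equiv.Perm (Fin n)) i))).filter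
        fun q => q.1 != q.2)).take m) es = true := by
  refine sat_iff_sat_weaker F hF _ (fun a hmax g m => ?_)
  have hle : (g : Equiv.Perm (Fin n))⁻¹ • a ≤ a := by
    have := hmax g⁻¹
    rwa [Subgroup.smul_def, Subgroup.coe_inv] at this
  have hnot : ¬ toLex (ofLex a) < toLex (ofLex a ∘ (g : Equiv.Perm (Fin n))) := by
    rw [toLex_comp_eq_inv_smul, toLex_ofLex, not_lt]
    exact hle
  exact (chain_satisfiable_of_not_lex_lt (ofLex a) (g : Equiv.Perm (Fin n)) hnot m).2

/-- Refutation form: if `F` plus the chains (any `G`-family, moved positions, any prefix) is UNSAT then `F` is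
UNSAT — the use made of a DRAT-certified `--lexstab` leg. -/
theorem unsat_of_unsat_with_chains {n : ℕ} (G : Subgroup (Equiv.Perm (Fin n))) [Fintype G]
    (F : Lex (Fin n → Bool) → Prop) (hF : ∀ (g : G) (a : Lex (Fin n → Bool)), F a → F (g • a))
    (h : ¬ ∃ a, F a ∧ ∀ g : G, ∀ m : ℕ, ∃ es,
      chainSat true ((((List.ofFn fun i => (ofLex a i, ofLex a ((g : Equiv.Perm (Fin n)) i))).filter
        fun q => q.1 != q.2)).take m) es = true) :
    ¬ ∃ a, F a :=
  fun hex => h ((sat_iff_sat_with_chains G F hF).mp hex)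

end EndToEnd

end LexChain
end Summit.Ventures.HSemireg
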